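import Literature.Combinatorics.SimpleGraph.MatchingMinorIsomorphism
import HarnessLib

/-!
# Matching minors: monotonicity, central subgraphs of central subgraphs, relabelling

Topic `Combinatorics/SimpleGraph`; theorems only. Tools for the hard direction of Little's theorem
(`Little1975_isPfaffianBipartite_iff_not_isMatchingMinor`, `LittleTheorem.lean`), whose proof is a
descending induction along matching minors and needs to LIFT a `K_{3,3}` matching minor of a
smaller graph back to the original graph, in the edge-set encoding of `MatchingMinor.lean`
(`IsCentralSubgraph`, `Bicontracts`, `IsMatchingMinor`, `relabel`, `transposeEdges`):

* `IsCentralSubgraph.mono`, `IsMatchingMinor.mono` — adding edges to the host keeps central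
  subgraphs and matching minors (edge deletion is a matching-minor operation);
* `IsCentralSubgraph.trans`, `IsMatchingMinor.of_isCentralSubgraph` companion
  `IsCentralSubgraph.isMatchingMinor_trans` — a central subgraph of a central subgraph is central
  (compose the embeddings, unite the two complementary perfect matchings), so a matching minor of
  a central subgraph is a matching minor;
* `IsIsomorphic.trans`, `Bicontracts.of_isIsomorphic_left`, `Bicontracts.trans` — bookkeeping;
* `IsCentralSubgraph.relabel_host`, `IsCentralSubgraph.transposeEdges_host`,
  `IsMatchingMinor.relabel_host`, `IsMatchingMinor.transposeEdges_host`,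
  `IsMatchingMinor.of_relabel_host`, `IsMatchingMinor.of_transposeEdges_host`
  — matching minors are transported along independent relabellings of rows and columns and along
  the exchange of the two colour classes of the HOST (the special isomorphisms used to put a vertex
  of degree two into normal position before bicontracting it).

## References

* N. Robertson, P. D. Seymour, R. Thomas, *Permanents, Pfaffian orientations, and even directed
  circuits*, Ann. of Math. 150 (1999) 929–975, §1 (central subgraphs), §4 (weak containment).
  [RobertsonSeymourThomas1999]
-/

namespace Literature.Combinatorics.SimpleGraph

open Equiv Finset

/-! ### Monotonicity in the host -/

section Mono

variable {k m n : ℕ}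

/-- A central subgraph of `G` is a central subgraph of every supergraph of `G` on the same vertex
set. [folklore] -/
theorem IsCentralSubgraph.mono {K : Finset (Fin k × Fin k)} {G G' : Finset (Fin n × Fin n)}
    (h : IsCentralSubgraph K G) (hGG' : G ⊆ G') : IsCentralSubgraph K G' := by
  obtain ⟨r, c, hK, τ, hτ⟩ := h
  exact ⟨r, c, fun e he => hGG' (hK e he), τ, fun i => hGG' (hτ i)⟩

/-- **Matching minors are monotone in the host**: a matching minor of `G` is a matching minor of
every `G' ⊇ G` on the same vertex set (equivalently: deleting edges is a matching-minor
operation). [folklore] -/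
theorem IsMatchingMinor.mono {H : Finset (Fin m × Fin m)} {G G' : Finset (Fin n × Fin n)}
    (h : IsMatchingMinor H G) (hGG' : G ⊆ G') : IsMatchingMinor H G' := by
  obtain ⟨k, K, hK, hB⟩ := h
  exact ⟨k, K, hK.mono hGG', hB⟩

end Mono

/-! ### Central subgraphs of central subgraphs -/

section Trans

variable {j k n : ℕ}

/-- **A central subgraph of a central subgraph is a central subgraph** (Robertson–Seymour–Thomas
1999, §1): compose the row and column embeddings; the complement of `J` in `G` is the complement
of `K` in `G` together with the image of the complement of `J` in `K`, perfectly matched by the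
two given matchings. [folklore] -/
theorem IsCentralSubgraph.trans {J : Finset (Fin j × Fin j)} {K : Finset (Fin k × Fin k)}
    {G : Finset (Fin n × Fin n)} (hJK : IsCentralSubgraph J K) (hKG : IsCentralSubgraph K G) :
    IsCentralSubgraph J G := by
  classical
  obtain ⟨rJ, cJ, hJ, τJ, hτJ⟩ := hJK
  obtain ⟨rK, cK, hK, τK, hτK⟩ := hKG
  -- splitting the complement of `range (g ∘ f)` as (complement of `range g`) ⊕ `g ''` (complement
  -- of `range f`)
  have split : ∀ (f : Fin j ↪ Fin k) (g : Fin k ↪ Fin n),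
      ∃ E : ({i : Fin n // i ∉ Set.range g} ⊕ {a : Fin k // a ∉ Set.range f}) ≃
          {i : Fin n // i ∉ Set.range (f.trans g)},
        (∀ x, (E (Sum.inl x) : Fin n) = x) ∧ (∀ a, (E (Sum.inr a) : Fin n) = g a) := by
    intro f g
    let F : ({i : Fin n // i ∉ Set.range g} ⊕ {a : Fin k // a ∉ Set.range f}) →
        {i : Fin n // i ∉ Set.range (f.trans g)} :=
      Sum.elim (fun x => ⟨x.1, fun ⟨b, hb⟩ => x.2 ⟨f b, by simpa using hb⟩⟩)
        (fun a => ⟨g a.1, fun ⟨b, hb⟩ => a.2 ⟨b, g.injective (by simpa using hb)⟩⟩)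
    have hinj : Function.Injective F := by
      rintro (x | a) (y | b) h <;> have hv := congrArg Subtype.val h <;>
        simp only [F, Sum.elim_inl, Sum.elim_inr] at hv
      · exact congrArg Sum.inl (Subtype.ext hv)
      · exact absurd ⟨b.1, hv.symm⟩ x.2
      · exact absurd ⟨a.1, hv⟩ y.2
      · exact congrArg Sum.inr (Subtype.ext (g.injective hv))
    have hsurj : Function.Surjective F := by
      intro i
      by_cases h : (i : Fin n) ∈ Set.range g
      · obtain ⟨a, ha⟩ := h
        refine ⟨Sum.inr ⟨a, fun ⟨b, hb⟩ => i.2 ⟨b, ?_⟩⟩, Subtype.ext ha⟩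
        simp [hb, ha]
      · exact ⟨Sum.inl ⟨i, h⟩, rfl⟩
    exact ⟨Equiv.ofBijective F ⟨hinj, hsurj⟩, fun x => rfl, fun a => rfl⟩
  obtain ⟨Er, hEr₁, hEr₂⟩ := split rJ rK
  obtain ⟨Ec, hEc₁, hEc₂⟩ := split cJ cK
  refine ⟨rJ.trans rK, cJ.trans cK, fun e he => hK _ (hJ e he),
    Er.symm.trans ((Equiv.sumCongr τK τJ).trans Ec), fun i => ?_⟩
  obtain ⟨y, rfl⟩ := Er.surjective i
  simp only [Equiv.trans_apply, Equiv.symm_apply_apply]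
  rcases y with x | a
  · rw [hEr₁, Equiv.sumCongr_apply, Sum.map_inl, hEc₁]
    exact hτK x
  · rw [hEr₂, Equiv.sumCongr_apply, Sum.map_inr, hEc₂]
    exact hK _ (hτJ a)

/-- **A matching minor of a central subgraph is a matching minor.** [folklore] -/
theorem IsCentralSubgraph.isMatchingMinor_trans {m : ℕ} {H : Finset (Fin m × Fin m)}
    {K : Finset (Fin k × Fin k)} {G : Finset (Fin n × Fin n)} (hKG : IsCentralSubgraph K G)
    (h : IsMatchingMinor H K) : IsMatchingMinor H G := by
  obtain ⟨j, J, hJK, hB⟩ := h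
  exact ⟨j, J, hJK.trans hKG, hB⟩

end Trans

/-! ### Isomorphism bookkeeping -/

section Iso

variable {n m : ℕ}

/-- `IsIsomorphic` is transitive. [folklore] -/
theorem IsIsomorphic.trans {G G' G'' : Finset (Fin n × Fin n)} (h : IsIsomorphic G G')
    (h' : IsIsomorphic G' G'') : IsIsomorphic G G'' := by
  obtain ⟨φ, hφ⟩ := h
  obtain ⟨ψ, hψ⟩ := h'
  exact ⟨φ.trans ψ, fun a b => (hφ a b).trans (hψ _ _)⟩

/-- A bicontraction sequence may start with any isomorphic graph. [folklore] -/
theorem Bicontracts.of_isIsomorphic_left {G G₂ : Finset (Fin n × Fin n)}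
    {H : Finset (Fin m × Fin m)} (h : Bicontracts G H) (hiso : IsIsomorphic G G₂) :
    Bicontracts G₂ H := by
  cases h with
  | of_isIsomorphic h1 => exact Bicontracts.of_isIsomorphic (hiso.symm.trans h1)
  | step hstep hrest =>
    obtain ⟨G₀, h₁, h₂, h₃⟩ := hstep
    exact Bicontracts.step ⟨G₀, hiso.symm.trans h₁, h₂, h₃⟩ hrest

/-- Bicontraction sequences compose. [folklore] -/
theorem Bicontracts.trans {k : ℕ} {G : Finset (Fin n × Fin n)} {H : Finset (Fin m × Fin m)}
    {H' : Finset (Fin k × Fin k)} (h : Bicontracts G H) (h' : Bicontracts H H') :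
    Bicontracts G H' := by
  induction h with
  | of_isIsomorphic hiso => exact h'.of_isIsomorphic_left hiso.symm
  | step hstep _ ih => exact Bicontracts.step hstep (ih h')

/-- A matching minor of a graph reached by bicontractions from a matching minor… simplest case:
matching minors of `H` are matching minors of `G` when `H` is obtained from `G` itself by
bicontractions and the minor of `H` is `H`-central with empty complement, i.e. `Bicontracts`
followed by `Bicontracts`. [folklore] -/
theorem Bicontracts.isMatchingMinor {k : ℕ} {G : Finset (Fin n × Fin n)}
    {H : Finset (Fin m × Fin m)} {H' : Finset (Fin k × Fin k)} (h : Bicontracts G H)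
    (h' : Bicontracts H H') : IsMatchingMinor H' G :=
  IsMatchingMinor.of_bicontracts (h.trans h')

end Iso

/-! ### Transport along relabellings and the row/column exchange of the host -/

section Relabel

variable {k m n : ℕ}

/-- Membership in the transpose. [folklore] -/
theorem mem_transposeEdges_iff (G : Finset (Fin n × Fin n)) (e : Fin n × Fin n) :
    e ∈ transposeEdges G ↔ (e.2, e.1) ∈ G := by
  simp only [transposeEdges, Finset.mem_map_equiv]
  rfl

/-- Transposing twice is the identity. [folklore] -/
@[simp] theorem transposeEdges_transposeEdges (G : Finset (Fin n × Fin n)) :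
    transposeEdges (transposeEdges G) = G := by
  ext e
  rw [mem_transposeEdges_iff, mem_transposeEdges_iff]

/-- Relabelling back. [folklore] -/
theorem relabel_relabel_symm (G : Finset (Fin n × Fin n)) (ρ κ : Perm (Fin n)) :
    relabel (relabel G ρ κ) ρ.symm κ.symm = G := by
  ext e
  rw [mem_relabel_iff, mem_relabel_iff]
  simp

/-- A central subgraph stays central after relabelling the rows and columns of the host.
[folklore] -/
theorem IsCentralSubgraph.relabel_host {K : Finset (Fin k × Fin k)} {G : Finset (Fin n × Fin n)}
    (h : IsCentralSubgraph K G) (ρ κ : Perm (Fin n)) : IsCentralSubgraph K (relabel G ρ κ) := by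
  obtain ⟨r, c, hK, τ, hτ⟩ := h
  have hr : ∀ i : Fin n, i ∈ Set.range (r.trans ρ.toEmbedding) ↔ ρ.symm i ∈ Set.range r := by
    intro i
    constructor
    · rintro ⟨a, rfl⟩; exact ⟨a, by simp⟩
    · rintro ⟨a, ha⟩; exact ⟨a, by simp [ha]⟩
  have hc : ∀ x : Fin n, x ∈ Set.range (c.trans κ.toEmbedding) ↔ κ.symm x ∈ Set.range c := by
    intro x
    constructor
    · rintro ⟨a, rfl⟩; exact ⟨a, by simp⟩
    · rintro ⟨a, ha⟩; exact ⟨a, by simp [ha]⟩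
  let eR : {i : Fin n // i ∉ Set.range (r.trans ρ.toEmbedding)} ≃ {i : Fin n // i ∉ Set.range r} :=
    ρ.symm.subtypeEquiv fun i => not_congr (hr i)
  let eC : {x : Fin n // x ∉ Set.range (c.trans κ.toEmbedding)} ≃ {x : Fin n // x ∉ Set.range c} :=
    κ.symm.subtypeEquiv fun x => not_congr (hc x)
  refine ⟨r.trans ρ.toEmbedding, c.trans κ.toEmbedding, fun e he => ?_,
    eR.trans (τ.trans eC.symm), fun i => ?_⟩
  · rw [mem_relabel_iff]
    simpa using hK e he
  · rw [mem_relabel_iff]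
    have h1 : (κ.symm ((eR.trans (τ.trans eC.symm)) i : Fin n)) = (τ (eR i) : Fin n) := by
      simp [eC, Equiv.subtypeEquiv]
    have h2 : ρ.symm (i : Fin n) = (eR i : Fin n) := by simp [eR, Equiv.subtypeEquiv]
    simp only
    rw [h1, h2]
    exact hτ (eR i)

/-- A central subgraph of `G` gives, transposed, a central subgraph of the transposed host.
[folklore] -/
theorem IsCentralSubgraph.transposeEdges_host {K : Finset (Fin k × Fin k)}
    {G : Finset (Fin n × Fin n)} (h : IsCentralSubgraph K G) :
    IsCentralSubgraph (transposeEdges K) (transposeEdges G) := by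
  obtain ⟨r, c, hK, τ, hτ⟩ := h
  refine ⟨c, r, fun e he => ?_, τ.symm, fun j => ?_⟩
  · rw [mem_transposeEdges_iff] at he ⊢
    exact hK _ he
  · rw [mem_transposeEdges_iff]
    simpa using hτ (τ.symm j)

/-- **Matching minors survive relabelling the host.** [folklore] -/
theorem IsMatchingMinor.relabel_host {H : Finset (Fin m × Fin m)} {G : Finset (Fin n × Fin n)}
    (h : IsMatchingMinor H G) (ρ κ : Perm (Fin n)) : IsMatchingMinor H (relabel G ρ κ) := by
  obtain ⟨k, K, hK, hB⟩ := h
  exact ⟨k, K, hK.relabel_host ρ κ, hB⟩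

/-- … and un-relabelling. [folklore] -/
theorem IsMatchingMinor.of_relabel_host {H : Finset (Fin m × Fin m)} {G : Finset (Fin n × Fin n)}
    {ρ κ : Perm (Fin n)} (h : IsMatchingMinor H (relabel G ρ κ)) : IsMatchingMinor H G := by
  simpa [relabel_relabel_symm] using h.relabel_host ρ.symm κ.symm

/-- **Matching minors survive exchanging the colour classes of the host** (the minor is
transposed too, which is an isomorphic graph). [folklore] -/
theorem IsMatchingMinor.transposeEdges_host {H : Finset (Fin m × Fin m)}
    {G : Finset (Fin n × Fin n)} (h : IsMatchingMinor H G) : IsMatchingMinor H (transposeEdges G) := by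
  obtain ⟨k, K, hK, hB⟩ := h
  exact ⟨k, _, hK.transposeEdges_host, hB.of_isIsomorphic_left (isIsomorphic_transposeEdges K)⟩

/-- … and back. [folklore] -/
theorem IsMatchingMinor.of_transposeEdges_host {H : Finset (Fin m × Fin m)}
    {G : Finset (Fin n × Fin n)} (h : IsMatchingMinor H (transposeEdges G)) : IsMatchingMinor H G := by
  simpa using h.transposeEdges_host

end Relabel

end Literature.Combinatorics.SimpleGraph
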